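import Mathlib
import Summits.MatrixMultiplication.MatrixMultiplication.Theorems.LieRankDesigns.Negative.Basics
import Summits.MatrixMultiplication.MatrixMultiplication.Theorems.LevelGradedCohnUmansLieRankDesignsStubFrameFnLevel

/-!
# `LieRankDesigns` (stmt-MatrixMultiplication-7614), line `Sketch`: stub `stub_rankSepOfFreeFrames` — free-frame designs are rank-`k` separated

Crux `Summit.MatrixMultiplication.MatrixMultiplication.Theses.LevelGradedCohnUmans.LieRankDesigns`
(stmt-MatrixMultiplication-7614), line `Sketch`, lead seat prover-line-stmt-MatrixMultiplication-7614-c4-0.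
This file proves the registered stub `stub_rankSepOfFreeFrames` verbatim (name + signature) and lands
`--supports stmt-MatrixMultiplication-7614`: the level-`k` FREE-FRAME criterion, generalising
`stub_rankSepOfPrivateTokens` (p117553, the case `k = 1`, column vectors) to every level `k`.

**Free frames.**  `G = GL_m(𝔽_p)` acts on `m × k` frames `U ∈ M_{m×k}(𝔽_p)` by left multiplication.  Say a
triple `X, Y, Z ⊆ G` has FREE FRAMES if for every target `(x₀, z₀) ∈ X × Z` there is a frame `U` that the based
quadruple products move to where the target moves it only in the trivial case:

  `x⁻¹ y y'⁻¹ z · U = x₀⁻¹ z₀ · U  ⟹  x = x₀ ∧ y = y' ∧ z = z₀`   (`x ∈ X`, `y, y' ∈ Y`, `z ∈ Z`).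

Then the frame indicator `g ↦ 1[g U = x₀⁻¹ z₀ U]` separates the target, and it is a LEVEL-`k` test function:
it is the `k`-frame function `g ↦ Σ_{U'} φ(U', g U')` with kernel `φ(U', W) = [U' = U]·[W = x₀⁻¹ z₀ U]`, which
lies in `F_k` by the landed frame duality `stub_frameFnLevel` (stub K, p93384).  Hence free-frame designs are
`RankSep k` (`stub_rankSepOfFreeFrames`).
-/

set_option linter.dupNamespace false

noncomputable section

open scoped BigOperators
open Literature.RepresentationTheory.FiniteGroups
open Summit.MatrixMultiplication.MatrixMultiplication.Theorems.LieRankDesigns.Negative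
  (GLm Mat fourierFn RankSupp RankSep levelSet budget volume)

namespace Summit.MatrixMultiplication.MatrixMultiplication.Theorems.LieRankDesigns

namespace FreeFrame

variable {p m k : ℕ} [Fact p.Prime]

/-- **The single-frame indicator is a level-`k` test function**: for frames `U₀, W₀ ∈ M_{m×k}(𝔽_p)` there is
a rank-`≤ k`-supported Fourier table `c` with `fourierFn c g = 1[g U₀ = W₀]` on `GL_m(𝔽_p)` — the `k`-frame
function with kernel `φ(U, W) = [U = U₀][W = W₀]`, in `F_k` by `stub_frameFnLevel`. -/
theorem exists_frameIndicatorCoeff (U₀ W₀ : Matrix (Fin m) (Fin k) (ZMod p)) :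
    ∃ c : Mat p m → ℂ, RankSupp k c ∧
      ∀ g : GLm p m, fourierFn c g = if (g : Mat p m) * U₀ = W₀ then 1 else 0 := by
  classical
  set φ : Matrix (Fin m) (Fin k) (ZMod p) → Matrix (Fin m) (Fin k) (ZMod p) → ℂ :=
    fun U W => if U = U₀ ∧ W = W₀ then 1 else 0 with hφ
  obtain ⟨c, hc, hcf⟩ := stub_frameFnLevel p m k φ
  refine ⟨c, hc, fun g => ?_⟩
  rw [← hcf g]
  -- the frame sum collapses to the single frame `U₀`
  have hsum : (∑ U : Matrix (Fin m) (Fin k) (ZMod p), φ U ((g : Mat p m) * U)) = φ U₀ ((g : Mat p m) * U₀) :=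
    Finset.sum_eq_single U₀ (fun U _ hU => by simp [hφ, hU]) (fun h => (h (Finset.mem_univ _)).elim)
  show (∑ U : Matrix (Fin m) (Fin k) (ZMod p), φ U ((g : Mat p m) * U)) = _
  rw [hsum]
  simp only [hφ, true_and]

end FreeFrame

open FreeFrame

/-- **Free-frame designs are rank-`k` separated** (registered stub `stub_rankSepOfFreeFrames`; the level-`k`
form of `stub_rankSepOfPrivateTokens`).  If for every target `(x₀, z₀)` some frame `U ∈ M_{m×k}(𝔽_p)` is moved
to `x₀⁻¹ z₀ U` by a based quadruple product `x⁻¹ y y'⁻¹ z` only in the trivial case, then `RankSep k X Y Z`: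
the separator is the single-frame indicator `1[g U = x₀⁻¹ z₀ U] ∈ F_k`. -/
theorem stub_rankSepOfFreeFrames :
    ∀ (p m k : ℕ) [Fact p.Prime] (X Y Z : Finset (GLm p m)),
      (∀ x₀ ∈ X, ∀ z₀ ∈ Z, ∃ U : Matrix (Fin m) (Fin k) (ZMod p), ∀ x ∈ X, ∀ y ∈ Y, ∀ y' ∈ Y, ∀ z ∈ Z,
        ((x⁻¹ * y * y'⁻¹ * z : GLm p m) : Mat p m) * U = ((x₀⁻¹ * z₀ : GLm p m) : Mat p m) * U →
          x = x₀ ∧ y = y' ∧ z = z₀) →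
      RankSep k X Y Z := by
  intro p m k _ X Y Z h x₀ hx₀ z₀ hz₀
  obtain ⟨U, hsep⟩ := h x₀ hx₀ z₀ hz₀
  obtain ⟨c, hc, hcf⟩ := exists_frameIndicatorCoeff U (((x₀⁻¹ * z₀ : GLm p m) : Mat p m) * U)
  refine ⟨c, hc, fun x hx y hy y' hy' z hz => ?_⟩
  rw [hcf]
  by_cases hq : x = x₀ ∧ y = y' ∧ z = z₀
  · rw [if_pos hq]
    obtain ⟨hxx, hyy, hzz⟩ := hq
    rw [hxx, hyy, hzz, mul_inv_cancel_right, if_pos rfl]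
  · rw [if_neg hq, if_neg fun hgU => hq (hsep x hx y hy y' hy' z hz hgU)]

end Summit.MatrixMultiplication.MatrixMultiplication.Theorems.LieRankDesigns

end
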